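import Mathlib.Analysis.InnerProductSpace.PiL2

/-!
# Route FeketeSOS — crux `FeketeSOSHard` (stmt-ValiantsHypothesis-3996), line `paley-rip` v3,
# `stub_tameOperator` on direct sumsets, piece 1: low-rank symmetric tensors are cheap
# (`‖Σ_i c_i v_i v_iᵀ‖_nuclear ≤ √r · ‖Σ_i c_i v_i v_iᵀ‖_F`, WITHOUT Takagi's factorisation)

The §9 programme for `stub_tameOperator` on direct sumsets `D + [0,k)` (`Cruxes/FeketeSOSHard/TameOperatorDplusH.md`,
`Cruxes/FeketeSOSHard/Lines/paley-rip-pieceB-interval.md`) needs, at each Fourier frequency, a cheap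
re-representation of a rank-`≤ r` complex symmetric tensor `C = Σ_{i<r} c_i v_i v_iᵀ` on a finite index set:
weights `λ_j` and vectors `g_j` with `Σ_j λ_j g_j g_jᵀ = C` and `Σ_j |λ_j|·‖g_j‖₂² ≤ √r · ‖C‖_F`.
Takagi's factorisation gives this with the trace norm; here it is proved by elementary means:

* take an orthonormal basis `e_1, …, e_q` (`q ≤ r`) of `span{v_i}` (Gram–Schmidt = `stdOrthonormalBasis`);
* `v_i = Σ_a ⟪e_a, v_i⟫ e_a` gives `C = Σ_a u_a e_aᵀ = Σ_a e_a u_aᵀ` with `u_a = Σ_i c_i ⟪e_a, v_i⟫ v_i = C ē_a`;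
* BALANCED POLARISATION `u eᵀ + e uᵀ = (1/2s)[(u + s e)(u + s e)ᵀ − (u − s e)(u − s e)ᵀ]`, `s = ‖u‖`, costs
  exactly `2s` (parallelogram law), so `C` costs `Σ_a ‖u_a‖ ≤ √q (Σ_a ‖u_a‖²)^{1/2}`;
* `Σ_a ‖u_a‖² = Σ_α Σ_a |⟪e_a, ρ_α⟫|² ≤ Σ_α ‖ρ_α‖² = ‖C‖_F²` (`ρ_α` = the `α`-th row of `C`; Bessel).

Main result `symOuter_nuclear_le` (plain functions `ι → ℂ` in the statement; the squares vocabulary of the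
stub is attached in the sequel file).  Honest framing (rung currency): a Theorems-side helper `--supports`
stmt-3996; nothing here closes a registered stub; `stub_tameOperator`, `stub_paleyFlatRIP` and the crux stay
OPEN; `VP ≠ VNP` is untouched.
-/

set_option linter.dupNamespace false

namespace Summit.ValiantsHypothesis.ValiantsHypothesis.Theorems.FeketeSOSHardPaleyRIP

open Finset Module
open scoped BigOperators ComplexConjugate InnerProductSpace

noncomputable section

/-! ## Balanced polarisation of `u eᵀ + e uᵀ` -/

/-- Entrywise balanced polarisation: with `s = ‖u‖` and `t = (4s)⁻¹`,
`t·(u + s e)_α (u + s e)_β − t·(u − s e)_α (u − s e)_β = ½ (u_α e_β + e_α u_β)` (both sides vanish when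
`u = 0`). [folklore] -/
theorem polar_entry {ι : Type*} [Fintype ι] (u e : EuclideanSpace ℂ ι) (α β : ι) :
    (4 * (‖u‖ : ℂ))⁻¹ * ((u + (‖u‖ : ℂ) • e) α * (u + (‖u‖ : ℂ) • e) β) +
        -(4 * (‖u‖ : ℂ))⁻¹ * ((u - (‖u‖ : ℂ) • e) α * (u - (‖u‖ : ℂ) • e) β) =
      2⁻¹ * (u α * e β + e α * u β) := by
  by_cases hu : u = 0
  · subst hu
    simp
  · have hs : (‖u‖ : ℂ) ≠ 0 := by
      rw [Ne, Complex.ofReal_eq_zero, norm_eq_zero]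
      exact hu
    simp only [PiLp.add_apply, PiLp.sub_apply, PiLp.smul_apply, smul_eq_mul]
    field_simp
    ring

/-- The mass of the balanced polarisation is `‖u‖`: `|t|·‖u + s e‖² + |−t|·‖u − s e‖² = s` for `‖e‖ = 1`,
`s = ‖u‖`, `t = (4s)⁻¹` (parallelogram law). [folklore] -/
theorem polar_mass {ι : Type*} [Fintype ι] (u e : EuclideanSpace ℂ ι) (he : ‖e‖ = 1) :
    ‖(4 * (‖u‖ : ℂ))⁻¹‖ * ‖u + (‖u‖ : ℂ) • e‖ ^ 2 +
        ‖-(4 * (‖u‖ : ℂ))⁻¹‖ * ‖u - (‖u‖ : ℂ) • e‖ ^ 2 = ‖u‖ := by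
  have hpar := parallelogram_law_with_norm ℂ u ((‖u‖ : ℂ) • e)
  have hse : ‖(‖u‖ : ℂ) • e‖ = ‖u‖ := by
    rw [norm_smul, Complex.norm_real, Real.norm_eq_abs, abs_of_nonneg (norm_nonneg _), he, mul_one]
  rw [hse] at hpar
  have ht : ‖(4 * (‖u‖ : ℂ))⁻¹‖ = (4 * ‖u‖)⁻¹ := by
    rw [norm_inv, norm_mul, Complex.norm_real, Real.norm_eq_abs, abs_of_nonneg (norm_nonneg _)]
    norm_num
  rw [norm_neg, ht, ← mul_add, hpar]
  by_cases hu : ‖u‖ = 0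
  · rw [hu]; simp
  · field_simp
    ring

/-! ## The `√rank · Frobenius` bound -/

/-- Cauchy–Schwarz in the form `Σ_{a<q} s_a ≤ √q · (Σ_a s_a²)^{1/2}` for nonnegative reals. [folklore] -/
theorem sum_le_sqrt_card_mul_sqrt_sum_sq (q : ℕ) (s : Fin q → ℝ) (hs : ∀ a, 0 ≤ s a) :
    ∑ a, s a ≤ Real.sqrt q * Real.sqrt (∑ a, s a ^ 2) := by
  have hcs := Finset.sum_mul_sq_le_sq_mul_sq (Finset.univ : Finset (Fin q)) s (fun _ => (1 : ℝ))
  simp only [mul_one, one_pow, Finset.sum_const, Finset.card_univ, Fintype.card_fin, nsmul_eq_mul,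
    mul_one] at hcs
  have h0 : 0 ≤ ∑ a, s a := Finset.sum_nonneg fun a _ => hs a
  rw [← Real.sqrt_mul (Nat.cast_nonneg q), ← Real.sqrt_sq h0]
  exact Real.sqrt_le_sqrt (by linarith)

/-- **Low-rank symmetric tensors are cheap (`√r · Frobenius`, no Takagi).**  For scalars `c_i` and vectors
`v_i : ι → ℂ` (`i < r`) there are weights `λ_j` and vectors `g_j` with `Σ_j λ_j g_j(a) g_j(b) = Σ_i c_i v_i(a) v_i(b)`
for all `a, b` and `Σ_j |λ_j| Σ_a |g_j(a)|² ≤ √r · (Σ_{a,b} |Σ_i c_i v_i(a) v_i(b)|²)^{1/2}`.  (Orthonormal basis of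
`span{v_i}`, balanced polarisation, Bessel; see the module docstring.) [folklore] -/
theorem symOuter_nuclear_le {ι : Type*} [Fintype ι] [DecidableEq ι] (r : ℕ) (c : Fin r → ℂ)
    (v : Fin r → ι → ℂ) :
    ∃ (s : ℕ) (lam : Fin s → ℂ) (g : Fin s → ι → ℂ),
      (∀ a b, ∑ j, lam j * (g j a * g j b) = ∑ i, c i * (v i a * v i b)) ∧
      (∑ j, ‖lam j‖ * ∑ a, ‖g j a‖ ^ 2) ≤
        Real.sqrt r * Real.sqrt (∑ a, ∑ b, ‖∑ i, c i * (v i a * v i b)‖ ^ 2) := by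
  classical
  -- the vectors in the Euclidean space `ℂ^ι`
  let x : Fin r → EuclideanSpace ℂ ι := fun i => WithLp.toLp 2 (v i)
  have hx : ∀ i a, x i a = v i a := fun i a => rfl
  -- an orthonormal basis of their span
  let K : Submodule ℂ (EuclideanSpace ℂ ι) := Submodule.span ℂ (Set.range x)
  let q : ℕ := finrank ℂ K
  have hq : q ≤ r := (finrank_range_le_card (R := ℂ) x).trans (by simp)
  let bK : OrthonormalBasis (Fin q) ℂ K := stdOrthonormalBasis ℂ K
  let e : Fin q → EuclideanSpace ℂ ι := fun a => (bK a : EuclideanSpace ℂ ι)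
  have he : Orthonormal ℂ e := bK.orthonormal.comp_linearIsometry K.subtypeₗᵢ
  have he1 : ∀ a, ‖e a‖ = 1 := fun a => he.1 a
  have hxK : ∀ i, x i ∈ K := fun i => Submodule.subset_span ⟨i, rfl⟩
  have hrepr : ∀ i, ∑ a, ⟪e a, x i⟫_ℂ • e a = x i := by
    intro i
    have h := congrArg Subtype.val (bK.sum_repr' ⟨x i, hxK i⟩)
    rw [Submodule.coe_sum] at h
    simpa only [Submodule.coe_smul, Submodule.coe_inner] using h
  have hrepr' : ∀ i β, v i β = ∑ a, ⟪e a, x i⟫_ℂ * e a β := by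
    intro i β
    rw [← hx i β]
    conv_lhs => rw [← hrepr i]
    simp only [WithLp.ofLp_sum, WithLp.ofLp_smul, Finset.sum_apply, Pi.smul_apply, smul_eq_mul]
  -- `u_a = Σ_i c_i ⟪e_a, x_i⟫ x_i`
  let u : Fin q → EuclideanSpace ℂ ι := fun a => ∑ i, (c i * ⟪e a, x i⟫_ℂ) • x i
  have hu : ∀ a α, u a α = ∑ i, c i * ⟪e a, x i⟫_ℂ * v i α := by
    intro a α
    simp only [u, WithLp.ofLp_sum, WithLp.ofLp_smul, Finset.sum_apply, Pi.smul_apply, smul_eq_mul, hx]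
  -- `C(α,β) = Σ_a u_a(α) e_a(β) = Σ_a e_a(α) u_a(β)`
  have hC1 : ∀ α β, ∑ i, c i * (v i α * v i β) = ∑ a, u a α * e a β := by
    intro α β
    have key : ∀ i, c i * (v i α * v i β) = ∑ a, c i * ⟪e a, x i⟫_ℂ * v i α * e a β := by
      intro i
      rw [hrepr' i β, Finset.mul_sum, Finset.mul_sum]
      exact Finset.sum_congr rfl fun a _ => by ring
    rw [Finset.sum_congr rfl fun i _ => key i, Finset.sum_comm]
    exact Finset.sum_congr rfl fun a _ => by rw [hu, Finset.sum_mul]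
  have hC2 : ∀ α β, ∑ i, c i * (v i α * v i β) = ∑ a, e a α * u a β := by
    intro α β
    rw [show (∑ i, c i * (v i α * v i β)) = ∑ i, c i * (v i β * v i α) from
      Finset.sum_congr rfl fun i _ => by ring, hC1 β α]
    exact Finset.sum_congr rfl fun a _ => by ring
  -- the new family: for each `a`, the two polarised vectors `u_a ± ‖u_a‖ e_a`
  let lamP : Fin q → ℂ := fun a => (4 * (‖u a‖ : ℂ))⁻¹
  let gP : Fin q → EuclideanSpace ℂ ι := fun a => u a + (‖u a‖ : ℂ) • e a
  let gM : Fin q → EuclideanSpace ℂ ι := fun a => u a - (‖u a‖ : ℂ) • e a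
  refine ⟨q + q, Fin.append lamP (fun a => -lamP a),
    Fin.append (fun a => WithLp.ofLp (gP a)) (fun a => WithLp.ofLp (gM a)), ?_, ?_⟩
  · intro α β
    rw [Fin.sum_univ_add (M := ℂ)]
    simp only [Fin.append_left, Fin.append_right]
    rw [← Finset.sum_add_distrib,
      Finset.sum_congr rfl fun a _ => polar_entry (u a) (e a) α β, ← Finset.mul_sum,
      Finset.sum_add_distrib, ← hC1 α β, ← hC2 α β]
    ring
  · rw [Fin.sum_univ_add (M := ℝ)]
    simp only [Fin.append_left, Fin.append_right]
    have hnorm : ∀ (w : EuclideanSpace ℂ ι), ∑ a, ‖w a‖ ^ 2 = ‖w‖ ^ 2 := fun w =>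
      (EuclideanSpace.norm_sq_eq w).symm
    simp_rw [hnorm]
    rw [← Finset.sum_add_distrib, Finset.sum_congr rfl fun a _ => polar_mass (u a) (e a) (he1 a)]
    -- `Σ_a ‖u_a‖ ≤ √q (Σ_a ‖u_a‖²)^{1/2} ≤ √r ‖C‖_F`
    refine (sum_le_sqrt_card_mul_sqrt_sum_sq q (fun a => ‖u a‖) fun a => norm_nonneg _).trans ?_
    refine mul_le_mul (Real.sqrt_le_sqrt (by exact_mod_cast hq)) (Real.sqrt_le_sqrt ?_)
      (Real.sqrt_nonneg _) (Real.sqrt_nonneg _)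
    -- Bessel, row by row
    let ρ : ι → EuclideanSpace ℂ ι := fun α => ∑ i, (c i * x i α) • x i
    have hρ : ∀ α β, ρ α β = ∑ i, c i * (v i α * v i β) := by
      intro α β
      simp only [ρ, WithLp.ofLp_sum, WithLp.ofLp_smul, Finset.sum_apply, Pi.smul_apply, smul_eq_mul, hx]
      exact Finset.sum_congr rfl fun i _ => by ring
    have huρ : ∀ a α, u a α = ⟪e a, ρ α⟫_ℂ := by
      intro a α
      rw [hu]
      simp only [ρ, inner_sum, inner_smul_right, hx]
      exact Finset.sum_congr rfl fun i _ => by ring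
    calc ∑ a, ‖u a‖ ^ 2 = ∑ a, ∑ α, ‖u a α‖ ^ 2 := Finset.sum_congr rfl fun a _ => (hnorm (u a)).symm
      _ = ∑ α, ∑ a, ‖⟪e a, ρ α⟫_ℂ‖ ^ 2 := by
          rw [Finset.sum_comm]
          exact Finset.sum_congr rfl fun α _ => Finset.sum_congr rfl fun a _ => by rw [huρ]
      _ ≤ ∑ α, ‖ρ α‖ ^ 2 := Finset.sum_le_sum fun α _ => he.sum_inner_products_le (ρ α)
      _ = ∑ α, ∑ β, ‖∑ i, c i * (v i α * v i β)‖ ^ 2 :=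
          Finset.sum_congr rfl fun α _ => by
            rw [← hnorm (ρ α)]
            exact Finset.sum_congr rfl fun β _ => by rw [hρ]

end

end Summit.ValiantsHypothesis.ValiantsHypothesis.Theorems.FeketeSOSHardPaleyRIP
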